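import Summits.BirchSwinnertonDyer.Rank1Residual.P2.CongruentNumberPairsAtTwoSilentFiveDoor
import Summits.BirchSwinnertonDyer.Rank1Residual.P2.CongruentNumberPairsAtTwoOddDoorDescent
import HarnessLib

/-!
# Sub-lane «bsd-p2» / cell `bsd-monsky`: THE DOOR FOR `U₃⁰` (odd `n = p₅·q₇·r₇`, `(q/p) = (r/p) = −1`) WITHOUT Monsky's
# named fact — `ord_{s=1} L = 1`, rank `1`, `Ш[2^∞] = 0`, `BSD(E_n, 2) ⟺ ord₂ x = 3` from any datum, modulo GZK ONLY

HONEST FRAMING (sub-lane «bsd-p2», run/shared/lean/b2b/bsd-rank1-residual/p2/; cell `bsd-monsky`, run/shared/lean/pub/bsd-monsky/):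
the landed `U₃⁰` door (`P2/CongruentNumberPairsAtTwoSilentFiveDoor.lean`, shape D-CN-5) has binders `hM` (Monsky's odd `2`-descent
matrix theorem, used as `#Sel₂ = 8 ⟹ Ш[2^∞] = 0`) and `hGZK`; `s(n) = 1` on `U₃⁰` is its THEOREM `card_ker_monskyMatrixOdd_of_exceptionalFiveCfg`.
With the upper bound of Monsky's odd formula a tree theorem (`card_selmerGroup_two_le_pow_monskySelmerRankOdd`) and the uniform odd door
modulo GZK only (`rankOne_sha_bsdp_two_iff_congruentNumberCurve_prod_descent`, `P2/CongruentNumberPairsAtTwoOddDoorDescent.lean`), `hM`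
leaves: this file is the `U₃⁰` door on the exceptional configuration (`…_of_exceptionalFiveCfg_descent`) and in `(p, q, r)` form
(`…_five_seven_seven_descent`), binder `hGZK` ONLY. Per-pair biconditional; nothing asserted; closes no class (cell `openO12`);
the silent cells' `BSD(E_n, 2)` still needs a rank-one datum `x` (no printed theorem supplies it on `U₃⁰`).

References: [HeathBrown1994SelmerCongruentII] Appendix (Monsky), typescript p. 39 L10–L33 (odd case; upper bound a tree theorem);
[SilvermanAEC2009] Prop. X.1.4, X.4.9, Thm. X.4.2; [IrelandRosen1990] Ch. 5 §1 Prop. 5.1.2; [Miller2011LMS] Def. 1.1.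
-/

noncomputable section

open scoped Classical

open Matrix WeierstrassCurve Literature.NumberTheory.EllipticCurves
  Literature.NumberTheory.EllipticCurves.Rank1Residual
  Literature.NumberTheory.EllipticCurves.Rank1Residual.Typed
  Literature.NumberTheory.EllipticCurves.HeathBrown1994
  Literature.NumberTheory.EllipticCurves.TianYuanZhang2017
  Literature.NumberTheory.QuadraticFields
  Literature.NumberTheory.QuadraticFields.RedeiReichardt

set_option autoImplicit false

namespace Summit.BirchSwinnertonDyer.Rank1Residual.P2

section Door

variable (t : Fin 3 → ℕ)

/-- **THE DOOR FOR `U₃⁰` WITHOUT Monsky's fact (binder `hGZK` ONLY).** For distinct primes `t₀, t₁, t₂` in the exceptional class-`5`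
configuration (`p₅·q₇·r₇`, `(q/p) = (r/p) = −1`), `n = t₀t₁t₂`, and ANY rank-one datum `L′(E_n, 1) = x·Ω·Reg`, `x ≠ 0`:
`ord_{s=1} L(E_n, s) = 1`, rank `1`, `Ш(E_n)[2^∞] = 0` (`s(n) = 1` by the census theorem, `#Sel₂ ≤ 2^{2+s} = 8` by the tree's complete
`2`-descent, Silverman X.4.2), and `BSD(E_n, 2) ⟺ ord₂ x = 3`. Per-pair; closes no class. CONDITIONAL on `hGZK`; nothing asserted.
[cite: HeathBrown1994SelmerCongruentII, Appendix (Monsky), typescript p. 39 L10–L33] [cite: SilvermanAEC2009, Prop. X.1.4, Prop. X.4.9, Thm. X.4.2]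
[cite: Miller2011LMS, Def. 1.1 (arXiv:1010.2431 p. 3)] -/
theorem rankOne_sha_bsdp_two_iff_congruentNumberCurve_of_exceptionalFiveCfg_descent
    (hGZK : rank_eq_analyticRank_of_analyticRank_le_one)
    (ht : ∀ i, (t i).Prime) (hinj : Function.Injective t) {n : ℕ} (hn : ∏ i, t i = n)
    (hexc : exceptionalFiveCfg (fun i => t i % 8) (fun a b => kroneckerBit (t b) (t a)) = true)
    {x : ℚ} (hx0 : x ≠ 0)
    (hx : deriv (congruentNumberCurve n).entireLFunction 1 =
      (x : ℂ) * ((congruentNumberCurve n).realPeriodRat : ℂ) *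
        ((congruentNumberCurve n).regulator : ℂ)) :
    (congruentNumberCurve n).analyticRank = 1 ∧ (congruentNumberCurve n).mordellWeilRank = 1 ∧
      AddCommGroup.primaryComponent (congruentNumberCurve n).sha 2 = ⊥ ∧
      (BSDp (congruentNumberCurve n) 2 ↔ padicValRat 2 x = 3) := by
  have hres := mod_eight_of_exceptionalFiveCfg t hexc
  have ht2 : ∀ j, t j ≠ 2 := fun j h => by have := hres j; rw [h] at this; omega
  have hodd : ∀ j, Odd (t j) := fun j => (ht j).odd_of_ne_two (ht2 j)
  have h5 : n % 8 = 5 := hn ▸ prod_mod_eight_of_exceptionalFiveCfg t hexc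
  have hs : monskySelmerRankOdd t = 1 :=
    (monskySelmerRankOdd_eq_one_iff_card_ker t).mpr (card_ker_monskyMatrixOdd_of_exceptionalFiveCfg t ht hinj hexc)
  have h := rankOne_sha_bsdp_two_iff_congruentNumberCurve_prod_descent t hGZK ht hodd hinj hn (Or.inl h5) hs hx0 hx
  norm_num at h
  exact h

/-- **THE DOOR FOR `U₃⁰`, `(p, q, r)` form, WITHOUT Monsky's fact.** For primes `p ≡ 5`, `q ≡ r ≡ 7 (mod 8)`, `q ≠ r`, `(q/p) = (r/p) = −1`
and ANY rank-one datum `L′(E_{pqr}, 1) = x·Ω·Reg`, `x ≠ 0`: `ord_{s=1} L = 1`, rank `1`, `Ш[2^∞] = 0`, and `BSD(E_{pqr}, 2) ⟺ ord₂ x = 3`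
— modulo `hGZK` only. [cite: HeathBrown1994SelmerCongruentII, Appendix (Monsky), typescript p. 39 L10–L33]
[cite: IrelandRosen1990, Ch. 5 §1 Prop. 5.1.2] [cite: Miller2011LMS, Def. 1.1 (arXiv:1010.2431 p. 3)] -/
theorem rankOne_sha_bsdp_two_iff_congruentNumberCurve_five_seven_seven_descent
    (hGZK : rank_eq_analyticRank_of_analyticRank_le_one)
    {p q r : ℕ} (hp : p.Prime) (hq : q.Prime) (hr : r.Prime) (hp5 : p % 8 = 5) (hq7 : q % 8 = 7)
    (hr7 : r % 8 = 7) (hqr : q ≠ r) (hqp : jacobiSym q p = -1) (hrp : jacobiSym r p = -1)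
    {x : ℚ} (hx0 : x ≠ 0)
    (hx : deriv (congruentNumberCurve (p * q * r)).entireLFunction 1 =
      (x : ℂ) * ((congruentNumberCurve (p * q * r)).realPeriodRat : ℂ) *
        ((congruentNumberCurve (p * q * r)).regulator : ℂ)) :
    (congruentNumberCurve (p * q * r)).analyticRank = 1 ∧
      (congruentNumberCurve (p * q * r)).mordellWeilRank = 1 ∧
      AddCommGroup.primaryComponent (congruentNumberCurve (p * q * r)).sha 2 = ⊥ ∧
      (BSDp (congruentNumberCurve (p * q * r)) 2 ↔ padicValRat 2 x = 3) := by
  obtain ⟨ht, hinj, hexc⟩ := exceptionalFiveCfg_of_five_seven_seven hp hq hr hp5 hq7 hr7 hqr hqp hrp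
  have hn : ∏ i, ![p, q, r] i = p * q * r := by rw [Fin.prod_univ_three]; rfl
  exact rankOne_sha_bsdp_two_iff_congruentNumberCurve_of_exceptionalFiveCfg_descent _ hGZK ht hinj hn hexc hx0 hx

end Door

end Summit.BirchSwinnertonDyer.Rank1Residual.P2

end
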